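import Literature.AlgebraicGeometry.Resolution.ExcCurveMovingLemma
import Literature.AlgebraicGeometry.Resolution.IdealKernelScalarMul
import Literature.AlgebraicGeometry.Resolution.ExcCurveTwistAdditivity
import HarnessLib

/-!
# The self-intersection step `χ(𝒪_E(−L−E)) = χ(𝒪_E(−L)) − (E·E)` in `h⁰`-lengths
# (Lipman 1969, Prop. (13.1) b), d): the degree of the conormal sheaf, without Riemann–Roch)

Topic: `Literature/AlgebraicGeometry/Resolution`.  PROVED, fact-free, definition-free.  J. Lipman, *Rational
singularities …*, Publ. Math. IHÉS 36 (1969), §13 p. 223, computes `(E·E) = deg_E 𝒪_E(E)` through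
`χ(𝒪_E(D)) = χ(𝒪_E) + (D·E)`.  On a resolution `π : X → Spec A` of a two-dimensional Noetherian local domain with
`H¹(X, 𝒪_X) = 0` we obtain the SELF-STEP of that degree formula for the invertible ideals `𝓛 = ∏ 𝓘_ζ` (products
of prime ideals of integral exceptional curves) WITHOUT Riemann–Roch on `E`: move `E` by a global function `g`
with `(g) = 𝓘_E^a 𝓗` (`Resolution/ExcCurveMovingLemma`), use that multiplication by `g` is an isomorphism
`𝓛/𝓛𝓘_E ⥲ g𝓛/g𝓛𝓘_E` (`Resolution/IdealKernelScalarMul`), peel off `𝓗` (`Resolution/IdealKernelPeeling`,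
`(H·E) = −a(E·E)`), and convert `χ(𝓛/𝓛𝓘_E)` into `h⁰(𝒪/𝓛𝓘_E) − h⁰(𝒪/𝓛)` (`Resolution/ConormalSixTerm`):

* `h0_jump_of_moving` — `Δ(𝓛𝓘_E^a) = Δ(𝓛) − a·(E·E)` for `a = ord_E(g)`, where `Δ(𝓛) := h⁰(𝒪/𝓛𝓘_E) − h⁰(𝒪/𝓛)`;
* **`IsResolution.h0_prod_self_step`** — `Δ(𝓛𝓘_E) = Δ(𝓛) − (E·E)`, i.e.
  `h0(𝓛𝓘_E𝓘_E) − h0(𝓛𝓘_E) = h0(𝓛𝓘_E) − h0(𝓛) − (E·E)` (two base functions with `ord_E` equal to `a`, `a+1`).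

Together with the cross-step (`Resolution/ExcCurveTwistAdditivity`) this is the induction step of
`h0(𝓛𝓘_E) − h0(𝓛) = h⁰(E) − (L·E)`, from which Lipman's (13.1) b), d) in `h⁰`-form follow (not assembled here).

## References
* J. Lipman, Publ. Math. IHÉS 36 (1969), §13 Prop. (13.1) b), d) (p. 223), §14 (p. 224). [Lipman1969]
* D. Mumford, Publ. Math. IHÉS 9 (1961), p. 6.
-/

noncomputable section

-- `TopCat.Presheaf`/`Scheme.Modules` are not reducible (as in Mathlib's `AlgebraicGeometry/Modules`).
set_option backward.isDefEq.respectTransparency false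

open CategoryTheory CategoryTheory.Limits AlgebraicGeometry TopologicalSpace IsLocalRing Opposite
open Literature.AlgebraicGeometry.Morphisms Literature.AlgebraicGeometry.Modules
open Literature.AlgebraicGeometry.Motives Literature.AlgebraicGeometry.Motives.RatFn
open Scheme.IdealSheafData

universe u

namespace Literature.AlgebraicGeometry.Resolution

variable {A : Type u} [CommRing A] [IsNoetherianRing A] [IsLocalRing A] [IsDomain A]
  {X : Scheme.{u}} [IsIntegral X] [IsLocallyNoetherian X] (π : X ⟶ Spec (.of A))

omit [IsNoetherianRing A] [IsLocalRing A] [IsDomain A] [IsIntegral X] [IsLocallyNoetherian X] in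
/-- A quasi-compact scheme has a finite affine open cover indexed by a type in its own universe. [folklore] -/
private theorem exists_finite_isAffineOpen_cover₅ (X : Scheme.{u}) [CompactSpace X] :
    ∃ (κ : Type u) (_ : Finite κ) (U : κ → X.Opens), (∀ i, IsAffineOpen (U i)) ∧ ⨆ i, U i = ⊤ := by
  obtain ⟨s, hs, e⟩ := (isCompact_iff_finite_and_eq_biUnion_affineOpens (U := (⊤ : X.Opens))).mp
    (by simpa using isCompact_univ)
  haveI := hs.to_subtype
  refine ⟨s, inferInstance, fun i => i.1.1, fun i => i.1.2, ?_⟩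
  rw [iSup_subtype]
  exact e.symm

omit [IsNoetherianRing A] [IsLocalRing A] [IsDomain A] [IsIntegral X] [IsLocallyNoetherian X] in
/-- The projection `𝒪/J → 𝒪/J'` for `J ≤ J'`. [cite: StacksProject, Tag 01CL] -/
private theorem exists_proj {X : Scheme.{u}} (J J' : X.IdealSheafData) (h : J ≤ J') :
    ∃ q : idealQuot (unitModule X) J ⟶ idealQuot (unitModule X) J',
      idealQuotπ (unitModule X) J ≫ q = idealQuotπ (unitModule X) J' :=
  ⟨idealQuotDesc ((isKilledBy_idealQuot (unitModule X) J').anti h) (idealQuotπ _ _), idealQuotπ_desc _ _⟩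

omit [IsNoetherianRing A] [IsLocalRing A] [IsDomain A] [IsIntegral X] [IsLocallyNoetherian X] in
/-- **Transport**: the Euler-characteristic data of `K(J;𝓘) = ker(𝒪/J𝓘 → 𝒪/J)` only depend on the ideal `J`
(equal ideals, any compatible maps). [folklore] -/
private theorem length_kernel_congr {J₁ J₂ 𝓘 : X.IdealSheafData} (e : J₁ = J₂)
    (q₁ : idealQuot (unitModule X) (J₁ * 𝓘) ⟶ idealQuot (unitModule X) J₁)
    (hq₁ : idealQuotπ (unitModule X) (J₁ * 𝓘) ≫ q₁ = idealQuotπ (unitModule X) J₁)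
    (q₂ : idealQuot (unitModule X) (J₂ * 𝓘) ⟶ idealQuot (unitModule X) J₂)
    (hq₂ : idealQuotπ (unitModule X) (J₂ * 𝓘) ≫ q₂ = idealQuotπ (unitModule X) J₂)
    {ι : Type u} (U : ι → X.Opens) :
    Module.length A (MSections π (kernel q₁) ⊤) = Module.length A (MSections π (kernel q₂) ⊤) ∧
      Module.length A (CechMH1 π (kernel q₁) U) = Module.length A (CechMH1 π (kernel q₂) U) := by
  subst e
  have hq : q₁ = q₂ := idealQuot_hom_ext (by rw [hq₁, hq₂])
  subst hq
  exact ⟨rfl, rfl⟩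

omit [IsDomain A] [IsIntegral X] [IsLocallyNoetherian X] in
/-- `h⁰(𝒪/(∏_{ζ∈t} 𝓘_ζ · 𝓘_η^n))` is finite. [cite: Lipman1969, Section 10 (p. 212)] -/
private theorem h0_prod_mul_pow_ne_top [IsProper π] (t : Multiset X) (ht : ∀ ζ ∈ t, ζ ∈ excCurvePoints π)
    {η : X} (hη : η ∈ excCurvePoints π) (n : ℕ) :
    h0 π ((t.map primeDivisorIdeal).prod * primeDivisorIdeal η ^ n) ≠ ⊤ := by
  have e : (t.map primeDivisorIdeal).prod * primeDivisorIdeal η ^ n =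
      ((t + Multiset.replicate n η).map primeDivisorIdeal).prod := by
    rw [Multiset.map_add, Multiset.prod_add, Multiset.map_replicate, Multiset.prod_replicate]
  rw [e]
  exact h0_prod_primeDivisorIdeal_ne_top _ fun ζ hζ => by
    rcases Multiset.mem_add.mp hζ with h | h
    · exact ht ζ h
    · rw [Multiset.eq_of_mem_replicate h]; exact hη

omit [IsNoetherianRing A] [IsLocalRing A] [IsDomain A] [IsIntegral X] [IsLocallyNoetherian X] in
/-- `a + b = c + d` in `ℕ∞` with all four finite gives the integer identity. [folklore] -/
private theorem toNat_add_eq_of_add_eq' {a b c d : ℕ∞} (h : a + b = c + d) (ha : a ≠ ⊤) (hb : b ≠ ⊤) (hc : c ≠ ⊤)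
    (hd : d ≠ ⊤) : a.toNat + b.toNat = c.toNat + d.toNat := by
  have h' := congrArg ENat.toNat h
  rwa [ENat.toNat_add ha hb, ENat.toNat_add hc hd] at h'

/-- **The jump `Δ(𝓛𝓘_E^a) = Δ(𝓛) − a·(E·E)`, `a = ord_E(g)`** (`Δ(𝓛) := h0(𝓛𝓘_E) − h0(𝓛)`): on a resolution of a
two-dimensional Noetherian local domain with `H¹(X, 𝒪_X) = 0`, for `𝓛` a product of prime ideals of integral
exceptional curves, `E = E_η`, and a global function `g ≠ 0`: with `(g) = 𝓘_E^a 𝓗` (moving lemma),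
`χ(𝓛/𝓛𝓘_E) = χ(g𝓛/g𝓛𝓘_E) = χ(𝓛𝓘_E^a/𝓛𝓘_E^a𝓘_E) − (H·E)` and `(H·E) = −a(E·E)`.
[cite: Lipman1969, Section 13 (p. 223) with Section 14 (p. 224)] -/
theorem h0_jump_of_moving (hA : ringKrullDim A = 2) (hπ : IsResolution π) (h1 : HasTrivialCechH1 π)
    {η : X} (hη : η ∈ excCurvePoints π) (hE : IsEffectiveCartier (primeDivisorIdeal η))
    (γ : Γ(X, ⊤)) (hγ : secFn (show genericPoint X ∈ (⊤ : X.Opens) from trivial) γ ≠ 0)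
    (𝓛 : X.IdealSheafData) (t : Multiset X) (ht : ∀ ζ ∈ t, ζ ∈ excCurvePoints π)
    (h𝓛 : 𝓛 = (t.map primeDivisorIdeal).prod) :
    ∃ a : ℕ, (a : ℤ) = Scheme.ord (secFn (show genericPoint X ∈ (⊤ : X.Opens) from trivial) γ) η ∧
      ((h0 π (𝓛 * primeDivisorIdeal η ^ a * primeDivisorIdeal η)).toNat : ℤ) -
          (h0 π (𝓛 * primeDivisorIdeal η ^ a)).toNat =
        ((h0 π (𝓛 * primeDivisorIdeal η)).toNat : ℤ) - (h0 π 𝓛).toNat -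
          a * excCurveDegree π (CartierDivisor.ofIsEffectiveCartier (primeDivisorIdeal η) hE) η := by
  haveI : IsProper π := hπ.isProper
  haveI : CompactSpace X := QuasiCompact.compactSpace_of_compactSpace π
  have hX : Scheme.IsRegular X := hπ.isRegular
  obtain ⟨𝓗, a, Z, hHc, hηH, hHI, hspan, hZ, hZcl, hsupp, hfin, hnum, haord⟩ :=
    exists_moving_ideal hA hπ hη hE γ hγ
  refine ⟨a, haord, ?_⟩
  set 𝓘 := primeDivisorIdeal η with h𝓘
  obtain ⟨𝓛', h𝓛'⟩ : ∃ 𝓛' : X.IdealSheafData, 𝓛' = 𝓛 * 𝓘 ^ a := ⟨_, rfl⟩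
  obtain ⟨𝓖, h𝓖⟩ : ∃ 𝓖 : X.IdealSheafData, 𝓖 = 𝓘 ^ a * 𝓗 := ⟨_, rfl⟩
  rw [← h𝓖] at hspan
  have hL' : IsEffectiveCartier 𝓛' := by
    rw [h𝓛', h𝓛, h𝓘, ← Multiset.prod_replicate, ← Multiset.map_replicate, ← Multiset.prod_add, ← Multiset.map_add]
    exact isEffectiveCartier_prod_primeDivisorIdeal hX _ fun ζ hζ =>
      hπ.coheight_eq_one_of_mem_excCurvePoints hA ((Multiset.mem_add.mp hζ).elim (ht ζ) fun h => by
        rw [Multiset.eq_of_mem_replicate h]; exact hη)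
  -- finiteness of the `h0`
  have hfL : h0 π 𝓛 ≠ ⊤ := by rw [h𝓛]; exact h0_prod_primeDivisorIdeal_ne_top (π := π) t ht
  have hfLI : h0 π (𝓛 * 𝓘) ≠ ⊤ := by
    rw [h𝓛, h𝓘, ← pow_one (primeDivisorIdeal η)]; exact h0_prod_mul_pow_ne_top π t ht hη 1
  have hfL' : h0 π 𝓛' ≠ ⊤ := by rw [h𝓛', h𝓛, h𝓘]; exact h0_prod_mul_pow_ne_top π t ht hη a
  have hfL'I : h0 π (𝓛' * 𝓘) ≠ ⊤ := by
    rw [h𝓛', h𝓛, h𝓘, mul_assoc, ← pow_succ]; exact h0_prod_mul_pow_ne_top π t ht hη (a + 1)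
  -- the maps
  obtain ⟨q₀, hq₀⟩ := exists_proj (𝓛 * 𝓘) 𝓛 (fun U => Ideal.mul_le_right)
  obtain ⟨q₂, hq₂⟩ := exists_proj (𝓛' * 𝓘) 𝓛' (fun U => Ideal.mul_le_right)
  obtain ⟨q₁, hq₁⟩ := exists_proj (𝓛' * 𝓗 * 𝓘) (𝓛' * 𝓗) (fun U => Ideal.mul_le_right)
  obtain ⟨q₃, hq₃⟩ := exists_proj (𝓛' * (𝓗 ⊔ 𝓘)) 𝓛' (fun U => Ideal.mul_le_right)
  obtain ⟨pa, hpa⟩ := exists_proj (𝓛' * 𝓗 * 𝓘) (𝓛' * 𝓘) (by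
    intro U
    rw [ideal_mul, ideal_mul, ideal_mul, Pi.mul_apply, Pi.mul_apply, Pi.mul_apply]
    exact Ideal.mul_mono_left Ideal.mul_le_right)
  obtain ⟨pb, hpb⟩ := exists_proj (𝓛' * 𝓗) 𝓛' (fun U => Ideal.mul_le_right)
  obtain ⟨pc, hpc⟩ := exists_proj (𝓛' * 𝓘) (𝓛' * (𝓗 ⊔ 𝓘)) (by
    intro U
    rw [ideal_mul, ideal_mul, Pi.mul_apply, Pi.mul_apply, ideal_sup, Pi.sup_apply]
    exact Ideal.mul_mono_right le_sup_right)
  have w₁ : q₁ ≫ pb = pa ≫ q₂ := kernelPeel_sq₁ 𝓛' 𝓗 𝓘 q₁ q₂ hq₁ hq₂ pa hpa pb hpb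
  have w₂ : q₂ ≫ 𝟙 _ = pc ≫ q₃ := kernelPeel_sq₂ 𝓛' 𝓗 𝓘 q₂ q₃ hq₂ hq₃ pc hpc
  obtain ⟨q', hq'⟩ := exists_proj (𝓖 * 𝓛 * 𝓘) (𝓖 * 𝓛) (fun U => Ideal.mul_le_right)
  have hG : ∀ V : X.affineOpens, 𝓖.ideal V =
      Ideal.span {X.presheaf.map (homOfLE (le_top : (V : X.Opens) ≤ ⊤)).op γ} := hspan
  have hγV := mem_nonZeroDivisors_map_of_secFn_ne_zero γ hγ
  let μ₁ : idealQuot (unitModule X) (𝓛 * 𝓘) ⟶ idealQuot (unitModule X) (𝓖 * 𝓛 * 𝓘) :=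
    cokernel.desc (idealMulι (unitModule X) (𝓛 * 𝓘))
      (globalScalar (unitModule X) γ ≫ idealQuotπ (unitModule X) (𝓖 * 𝓛 * 𝓘))
      (idealMulι_globalScalar_idealQuotπ_mul₁ γ 𝓖 𝓛 𝓘 hG)
  have hμ₁ : idealQuotπ (unitModule X) (𝓛 * 𝓘) ≫ μ₁ =
      globalScalar (unitModule X) γ ≫ idealQuotπ (unitModule X) (𝓖 * 𝓛 * 𝓘) := cokernel.π_desc _ _ _
  let μ₂ : idealQuot (unitModule X) 𝓛 ⟶ idealQuot (unitModule X) (𝓖 * 𝓛) :=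
    cokernel.desc (idealMulι (unitModule X) 𝓛)
      (globalScalar (unitModule X) γ ≫ idealQuotπ (unitModule X) (𝓖 * 𝓛))
      (idealMulι_globalScalar_idealQuotπ_mul₂ γ 𝓖 𝓛 hG)
  have hμ₂ : idealQuotπ (unitModule X) 𝓛 ≫ μ₂ =
      globalScalar (unitModule X) γ ≫ idealQuotπ (unitModule X) (𝓖 * 𝓛) := cokernel.π_desc _ _ _
  have w : q₀ ≫ μ₂ = μ₁ ≫ q' := idealQuotScalarMul_sq γ 𝓖 𝓛 𝓘 q₀ hq₀ q' hq' μ₁ hμ₁ μ₂ hμ₂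
  -- a finite affine cover and the four identities
  obtain ⟨κ, _, U, hUaff, hUcov⟩ := exists_finite_isAffineOpen_cover₅ X
  have eA0 := hπ.h0_mul_add_length_cechMH1_kernel π hA h1 𝓛 𝓘 q₀ hq₀ U hUaff hUcov
  have eA2 := hπ.h0_mul_add_length_cechMH1_kernel π hA h1 𝓛' 𝓘 q₂ hq₂ U hUaff hUcov
  have eB := length_kernelPeel π 𝓛' 𝓗 𝓘 q₁ q₂ q₃ hq₁ hq₂ hq₃ pa hpa pb pc hpc w₁ w₂ hL'
    (mul_inf_mul_le_of_isEffectiveCartier 𝓛' 𝓗 𝓘 hL' hHI) hZ hZcl hsupp U hUaff hUcov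
  have eC := length_kernel_scalarMul_eq π γ 𝓖 𝓛 𝓘 hG hγV q₀ hq₀ q' hq' μ₁ hμ₁ μ₂ w U
  have eGL : 𝓖 * 𝓛 = 𝓛' * 𝓗 := by
    rw [h𝓖, h𝓛']
    rw [mul_assoc, mul_comm 𝓗 𝓛, ← mul_assoc, mul_comm (𝓘 ^ a) 𝓛]
  have eT := length_kernel_congr π eGL q' hq' q₁ hq₁ U
  -- names and finiteness
  set α₀ := Module.length A (MSections π (kernel q₀) ⊤) with hα₀
  set β₀ := Module.length A (CechMH1 π (kernel q₀) U) with hβ₀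
  set α₂ := Module.length A (MSections π (kernel q₂) ⊤) with hα₂
  set β₂ := Module.length A (CechMH1 π (kernel q₂) U) with hβ₂
  set α₁ := Module.length A (MSections π (kernel q₁) ⊤) with hα₁
  set β₁ := Module.length A (CechMH1 π (kernel q₁) U) with hβ₁
  have hα₁ : α₁ = α₀ := eT.1.symm.trans eC.1
  have hβ₁ : β₁ = β₀ := eT.2.symm.trans eC.2
  rw [hα₁, hβ₁] at eB
  -- `eB : α₀ + h0 (𝓗 ⊔ 𝓘) + β₂ = α₂ + β₀`
  have hα₀le : α₀ ≤ h0 π (𝓛 * 𝓘) := by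
    rw [h0_eq_length_MSections_idealQuot]
    exact Module.length_le_of_injective (MSections.app π (kernel.ι q₀) ⊤) (kernel_ι_app_injective q₀ ⊤)
  have hα₂le : α₂ ≤ h0 π (𝓛' * 𝓘) := by
    rw [h0_eq_length_MSections_idealQuot]
    exact Module.length_le_of_injective (MSections.app π (kernel.ι q₂) ⊤) (kernel_ι_app_injective q₂ ⊤)
  have fα₀ : α₀ ≠ ⊤ := ne_top_of_le_ne_top hfLI hα₀le
  have fα₂ : α₂ ≠ ⊤ := ne_top_of_le_ne_top hfL'I hα₂le
  have fβ₀ : β₀ ≠ ⊤ := by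
    refine ne_top_of_le_ne_top (WithTop.add_ne_top.mpr ⟨hfL, fα₀⟩) ?_
    rw [← eA0]
    exact le_add_self
  have fβ₂ : β₂ ≠ ⊤ := by
    refine ne_top_of_le_ne_top (WithTop.add_ne_top.mpr ⟨hfL', fα₂⟩) ?_
    rw [← eA2]
    exact le_add_self
  -- pass to `ℕ`
  have nA0 := toNat_add_eq_of_add_eq' eA0 hfLI fβ₀ hfL fα₀
  have nA2 := toNat_add_eq_of_add_eq' eA2 hfL'I fβ₂ hfL' fα₂
  have nB : α₀.toNat + (h0 π (𝓗 ⊔ 𝓘)).toNat + β₂.toNat = α₂.toNat + β₀.toNat := by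
    have h' := congrArg ENat.toNat eB
    rwa [ENat.toNat_add (WithTop.add_ne_top.mpr ⟨fα₀, hfin⟩) fβ₂, ENat.toNat_add fα₀ hfin,
      ENat.toNat_add fα₂ fβ₀] at h'
  have hm : ((h0 π (𝓗 ⊔ 𝓘)).toNat : ℤ) =
      -(a * excCurveDegree π (CartierDivisor.ofIsEffectiveCartier (primeDivisorIdeal η) hE) η) := hnum
  -- `Δ(𝓛') = α₂ − β₂ = α₀ + m − β₀ = Δ(𝓛) + m`
  have key : ((h0 π (𝓛' * 𝓘)).toNat : ℤ) - (h0 π 𝓛').toNat =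
      ((h0 π (𝓛 * 𝓘)).toNat : ℤ) - (h0 π 𝓛).toNat + (h0 π (𝓗 ⊔ 𝓘)).toNat := by
    omega
  rw [hm, h𝓛'] at key
  rw [key]
  ring

/-- **The self-intersection step `χ(𝒪_E(−L−E)) = χ(𝒪_E(−L)) − (E·E)` in `h⁰`-lengths**: on a resolution
`π : X → Spec A` of a two-dimensional Noetherian local domain with `H¹(X, 𝒪_X) = 0`, for `𝓛 = ∏_{ζ∈t} 𝓘_ζ` a product
of prime ideals of integral exceptional curves and `E = E_η` an integral exceptional curve,
`h0(𝓛𝓘_E𝓘_E) − h0(𝓛𝓘_E) = h0(𝓛𝓘_E) − h0(𝓛) − (E·E)` (integers; `(E·E) = excCurveDegree π [E] η`). Proof: two base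
functions with `ord_E` equal to `a` and `a+1` (`K(X) = Frac A`) give the jumps `Δ(𝓛𝓘_E^{a+1}) = Δ(𝓛) − (a+1)(E·E)`
and `Δ(𝓛𝓘_E·𝓘_E^a) = Δ(𝓛𝓘_E) − a(E·E)`. This is the repeated-curve case missing from the tree's disjoint / `η ≠ η′`
instances of Lipman's (13.1) b), d). [cite: Lipman1969, Proposition (13.1) b) and d) (p. 223)] -/
theorem IsResolution.h0_prod_self_step (hA : ringKrullDim A = 2) (hπ : IsResolution π) (h1 : HasTrivialCechH1 π)
    (t : Multiset X) (ht : ∀ ζ ∈ t, ζ ∈ excCurvePoints π) {η : X} (hη : η ∈ excCurvePoints π)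
    (hE : IsEffectiveCartier (primeDivisorIdeal η)) :
    let 𝓛 : X.IdealSheafData := (t.map primeDivisorIdeal).prod
    ((h0 π (𝓛 * primeDivisorIdeal η * primeDivisorIdeal η)).toNat : ℤ) - (h0 π (𝓛 * primeDivisorIdeal η)).toNat =
      ((h0 π (𝓛 * primeDivisorIdeal η)).toNat : ℤ) - (h0 π 𝓛).toNat -
        excCurveDegree π (CartierDivisor.ofIsEffectiveCartier (primeDivisorIdeal η) hE) η := by
  intro 𝓛
  have hX : Scheme.IsRegular X := hπ.isRegular
  have hco : Order.coheight η = 1 := hπ.coheight_eq_one_of_mem_excCurvePoints hA hη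
  obtain ⟨γ₁, γ₂, hγ₁, hγ₂, hord⟩ := exists_secFn_ord_eq_add_one π hπ.isBirational hX hco hE
  -- jump by `a + 1` from `𝓛`
  obtain ⟨a₂, ha₂, j₂⟩ := h0_jump_of_moving π hA hπ h1 hη hE γ₂ hγ₂ 𝓛 t ht rfl
  -- jump by `a` from `𝓛𝓘`
  have hmem : ∀ ζ ∈ t + {η}, ζ ∈ excCurvePoints π := fun ζ hζ =>
    (Multiset.mem_add.mp hζ).elim (ht ζ) fun h => by rw [Multiset.mem_singleton.mp h]; exact hη
  have hLI : 𝓛 * primeDivisorIdeal η = ((t + {η}).map primeDivisorIdeal).prod := by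
    change (t.map primeDivisorIdeal).prod * primeDivisorIdeal η = _
    rw [Multiset.map_add, Multiset.prod_add, Multiset.map_singleton, Multiset.prod_singleton]
  obtain ⟨a₁, ha₁, j₁⟩ := h0_jump_of_moving π hA hπ h1 hη hE γ₁ hγ₁ (𝓛 * primeDivisorIdeal η) (t + {η}) hmem hLI
  have ha : a₂ = a₁ + 1 := by
    have h : (a₂ : ℤ) = a₁ + 1 := by rw [ha₂, ha₁, hord]
    exact_mod_cast h
  subst ha
  rw [mul_assoc 𝓛 (primeDivisorIdeal η) (primeDivisorIdeal η ^ a₁), ← pow_succ'] at j₁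
  push_cast at j₂
  -- `j₂ : Δ(𝓛𝓘^{a+1}) = Δ(𝓛) − (a+1)c`, `j₁ : Δ(𝓛𝓘^{a+1}) = Δ(𝓛𝓘) − a c`
  linarith

end Literature.AlgebraicGeometry.Resolution

end
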